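import Summits.CriticalPhenomena.PercolationContinuityZ3.Theorems.PercNearOneGluingNoHeavyLowerTailSunflowerStarCompositionPrelim
import HarnessLib
import HarnessLib.Audit

/-!
# `NoHeavyLowerTail` (crux stmt-CriticalPhenomena-4575), abstract sunflower cubic: a STRENGTHENED ANTIPODAL GLADKOV INEQUALITY —
# on every cube, the Gladkov surplus pays for the (petal, kernel) antipodal pairs of a petal with a least element

Support file (seat `prim-l12-p2` gen 13; `--supports stmt-CriticalPhenomena-4575`).  Nothing is asserted about the crux; no `sorry`, no named facts.
Companion: `…SunflowerPrincipalPetal` (the partition lemma ★ for sunflowers with a least-element petal, which this inequality implies).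
Memo: run/shared/lean/prim/prim-l12/prim-l12-p2/FINDING-g13-PRINCIPAL-PETAL.md.

SETTING (`SunflowerPartition.Sunflower`: up-sets `V 0, V 1, V 2 ⊆ 2^α` with all pairwise intersections equal to the kernel `A`; `lab : 2^α → M₃`,
`0` bottom, `i+1` on the petal `V i ∖ A`, `4` = `⊤` kernel; `kk` the antipodal Gladkov kernel, `Sunflower.antipodal_sum_nonneg`).
HYPOTHESIS "petal `0` has a least element": a set `g ∈ V 0` with `g ⊆ S` for every petal-`0` set `S` (e.g. `V 0 ∖ A = ↑m ∖ A`, `g = m`).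

THEOREM `Sunflower.cube_le`: under this hypothesis (`g ≠ ∅`), for every cube `W ⊆ α`,
  `#{T ⊆ W : (lab T, lab (W∖T)) = (1,⊤)} + #{… = (⊤,1)} ≤ Σ_{T ⊆ W} kk (lab T) (lab (W ∖ T))`
(antipodal Gladkov says the right side is `≥ 0`; here it moreover pays for the petal-0/kernel antipodal pairs).
PROOF.  If `g ⊄ W` the left side is `0`.  Otherwise `W = g ⊔ W'`, `T = S ⊔ X` (`S ⊆ g`, `X ⊆ W'`, `sum_powerset_union_of_disjoint`), and
right − left is the member `E = ∅` of the POLARISED FAMILY `Θ(E;W') = Σ_{S ⊆ g} Σ_{X ⊆ W'} ψ_E(S,X)` (`Sunflower.psi`): for proper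
`∅ ≠ S ⊊ g`, `ψ` is the polarised Gladkov kernel `kk (lab (S ∪ E ∪ X)) (lab ((g∖S) ∪ E ∪ (W'∖X)))`; for `S = g` resp. `S = ∅` it is the
Harris-type term `[g ∪ E ∪ X ∈ V 1 ∪ V 2] − [E ∪ (W'∖X) ∈ V 1 ∪ V 2]` resp. the same with `X ↔ W'∖X` (pointwise identity `kk_eq_v23` on
pairs with labels in `{1,⊤} × (M₃ ∖ {1})`).  **`Θ ≥ 0`** (`Sunflower.theta_nonneg`) by the five-line induction of `antipodal_sum_nonneg`:
exposing `e ∈ W'`, the Harris-type terms regroup linearly and the Gladkov terms obey `kk_submod`, so `Θ(E;W'+e) ≥ Θ(E;W') + Θ(E+e;W')`;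
at `W' = ∅` the sum dominates termwise the polarised antipodal Gladkov sum of the cube `g` with offsets `(E,E)` (extreme terms `S ∈ {∅,g}` by
`kk (lab E) (lab (E ∪ g)) ≤ [E ∪ g ∈ V₁∪V₂] − [E ∈ V₁∪V₂]`, `kk_le_v23_of_mle`).  `Θ ≥ 0` holds for EVERY sunflower and every `g`
(no hypothesis); the least-element hypothesis enters only in the identification with the cube inequality.
Numerics (memo): the cube inequality has 0 violations in 123 864 random cubes when `V 0` is replaced by an ARBITRARY up-set (conjecture `IX-gen`,
which would give Lemma B whenever some petal is an intersecting family); the least-element case is the one proved here.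
-/
namespace Summit.CriticalPhenomena.PercolationContinuityZ3.Theorems.SunflowerPartition

open Finset

variable {α : Type*} [Fintype α] [DecidableEq α]

/-! ## Kernel facts on `M₃` (all by `decide`) -/

/-- Indicator of the labels `{2, 3, ⊤}` = membership in `V 1 ∪ V 2`. [this work] -/
def v23 (x : Fin 5) : ℤ := if x = 2 ∨ x = 3 ∨ x = 4 then 1 else 0

/-- Indicator of the label pair `(1, ⊤)` (petal `0`, kernel). [this work] -/
def ind14 (x y : Fin 5) : ℤ := if x = 1 ∧ y = 4 then 1 else 0

/-- On pairs (label in `{1,⊤}`, label `≠ 1`) the Gladkov kernel is the Harris-type difference plus the `(1,⊤)` indicator. [this work] -/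
theorem kk_eq_v23 : ∀ x y : Fin 5, (x = 1 ∨ x = 4) → y ≠ 1 → kk x y = v23 x - v23 y + ind14 x y := by decide

/-- For a comparable pair `a ≤ b` of `M₃` (as produced by `lab_mono`), `kk` in either order is at most `v23 b − v23 a`. [this work] -/
theorem kk_le_v23_of_mle : ∀ a b : Fin 5, (a = b ∨ a = 0 ∨ b = 4) → kk b a ≤ v23 b - v23 a ∧ kk a b ≤ v23 b - v23 a := by decide

namespace Sunflower

variable (F : Sunflower α)

/-! ## The polarised family `Θ` and its nonnegativity -/

/-- `vS T = [T ∈ V 1 ∪ V 2]` at the label level. [this work] -/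
def vS (T : Finset α) : ℤ := v23 (F.lab T)

/-- The summand `ψ_E(S,X)` of the polarised family for the cube `g ⊔ W`, offsets `E`: Harris-type for `S ∈ {g, ∅}`, polarised Gladkov kernel
for proper `S`. [this work] -/
def psi (g E W S X : Finset α) : ℤ :=
  if S = g then F.vS (g ∪ E ∪ X) - F.vS (E ∪ (W \ X))
  else if S = ∅ then F.vS (g ∪ E ∪ (W \ X)) - F.vS (E ∪ X)
  else kk (F.lab (S ∪ E ∪ X)) (F.lab ((g \ S) ∪ E ∪ (W \ X)))

omit [Fintype α] in
/-- `vS` is monotone. [this work] -/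
theorem vS_mono {S T : Finset α} (h : S ⊆ T) : F.vS S ≤ F.vS T := by
  have hm := F.lab_mono h
  have := (kk_le_v23_of_mle (F.lab S) (F.lab T) hm).1
  have hk : 0 ≤ kk (F.lab T) (F.lab S) := kk_nonneg_of_mle _ _ hm
  unfold vS; linarith

omit [Fintype α] in
/-- Base case, extreme terms: `kk (lab (E ∪ g)) (lab E) ≤ vS (g ∪ E) − vS E` and the same with `kk` reversed. [this work] -/
theorem kk_le_vS_sub (g E : Finset α) :
    kk (F.lab (E ∪ g)) (F.lab E) ≤ F.vS (g ∪ E) - F.vS E ∧ kk (F.lab E) (F.lab (E ∪ g)) ≤ F.vS (g ∪ E) - F.vS E := by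
  have hm := F.lab_mono (subset_union_left (s₁ := E) (s₂ := g))
  have h := kk_le_v23_of_mle (F.lab E) (F.lab (E ∪ g)) hm
  unfold vS
  rw [union_comm g E]
  exact h

/-- **`Θ(E;W) ≥ 0`** for every `W` and every offset set `E` (induction on `W`, à la `antipodal_sum_nonneg`). [this work] -/
theorem theta_nonneg (g : Finset α) : ∀ (W E : Finset α), 0 ≤ ∑ S ∈ g.powerset, ∑ X ∈ W.powerset, F.psi g E W S X := by
  intro W
  induction W using Finset.induction_on with
  | empty =>
    intro E
    simp only [powerset_empty, sum_singleton]
    -- termwise domination of the polarised antipodal Gladkov sum of the cube `g` with offsets `(E, E)`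
    have hG := F.antipodal_sum_nonneg g E E subset_rfl
    refine le_trans hG (sum_le_sum fun S hS => ?_)
    have hSg : S ⊆ g := mem_powerset.1 hS
    unfold psi
    by_cases h1 : S = g
    · subst h1
      simp only [if_true, sdiff_self, bot_eq_empty, union_empty]
      exact (F.kk_le_vS_sub S E).1
    · rw [if_neg h1]
      by_cases h2 : S = ∅
      · subst h2
        simp only [if_true, sdiff_empty, union_empty, empty_union]
        exact (F.kk_le_vS_sub g E).2
      · rw [if_neg h2]
        simp only [sdiff_empty, union_empty]
        rw [union_comm S E, union_comm (g \ S) E]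
  | insert e W' he ih =>
    intro E
    have hsplit : ∀ S ∈ g.powerset,
        ∑ X ∈ (insert e W').powerset, F.psi g E (insert e W') S X
          = ∑ X ∈ W'.powerset, (F.psi g E (insert e W') S X + F.psi g E (insert e W') S (insert e X)) := by
      intro S _
      rw [sum_powerset_insert he, sum_add_distrib]
    rw [sum_congr rfl hsplit]
    have key : ∀ S ∈ g.powerset, ∀ X ∈ W'.powerset,
        F.psi g E W' S X + F.psi g (insert e E) W' S X
          ≤ F.psi g E (insert e W') S X + F.psi g E (insert e W') S (insert e X) := by
      intro S hS X hX
      have hXW : X ⊆ W' := mem_powerset.1 hX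
      have heX : e ∉ X := fun hx => he (hXW hx)
      have e1 : insert e W' \ X = insert e (W' \ X) := insert_sdiff_of_notMem W' heX
      have e2 : insert e W' \ insert e X = W' \ X := insert_sdiff_insert_of_not_mem he
      unfold psi
      by_cases h1 : S = g
      · simp only [h1, if_true, e1, e2]
        rw [union_insert_eq e E (W' \ X), union_insert_eq e (g ∪ E) X, ← union_insert e g E]
        linarith
      · simp only [if_neg h1]
        by_cases h2 : S = ∅
        · simp only [h2, if_true, e1, e2]
          rw [union_insert_eq e (g ∪ E) (W' \ X), ← union_insert e g E, union_insert_eq e E X]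
          linarith
        · simp only [if_neg h2, e1, e2]
          rw [union_insert_eq e (g \ S ∪ E) (W' \ X), ← union_insert e (g \ S) E, union_insert_eq e (S ∪ E) X,
            ← union_insert e S E]
          have hm1 := F.lab_mono (union_subset_union (union_subset_union (subset_refl S) (subset_insert e E)) (subset_refl X))
          have hm2 := F.lab_mono (union_subset_union (union_subset_union (subset_refl (g \ S)) (subset_insert e E))
            (subset_refl (W' \ X)))
          have := kk_submod _ _ _ _ hm1 hm2
          linarith
    have hsum : ∑ S ∈ g.powerset, ∑ X ∈ W'.powerset, (F.psi g E W' S X + F.psi g (insert e E) W' S X)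
        ≤ ∑ S ∈ g.powerset, ∑ X ∈ W'.powerset, (F.psi g E (insert e W') S X + F.psi g E (insert e W') S (insert e X)) :=
      sum_le_sum fun S hS => sum_le_sum fun X hX => key S hS X hX
    have ih1 := ih E
    have ih2 := ih (insert e E)
    have hadd : ∑ S ∈ g.powerset, ∑ X ∈ W'.powerset, (F.psi g E W' S X + F.psi g (insert e E) W' S X)
        = (∑ S ∈ g.powerset, ∑ X ∈ W'.powerset, F.psi g E W' S X)
          + ∑ S ∈ g.powerset, ∑ X ∈ W'.powerset, F.psi g (insert e E) W' S X := by
      rw [← sum_add_distrib]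
      exact sum_congr rfl fun S _ => sum_add_distrib
    linarith


/-! ## The cube inequality: `(1,⊤)` and `(⊤,1)` antipodal pairs are paid by the Gladkov surplus -/

omit [Fintype α] in
/-- Sum over the powerset of a disjoint union `g ⊔ W'` as a double sum. [folklore] -/
theorem sum_powerset_union_of_disjoint {g W' : Finset α} (h : Disjoint g W') (f : Finset α → ℤ) :
    ∑ T ∈ (g ∪ W').powerset, f T = ∑ S ∈ g.powerset, ∑ X ∈ W'.powerset, f (S ∪ X) := by
  induction g using Finset.induction_on generalizing f with
  | empty => simp
  | insert a g' ha ih =>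
    have haW : a ∉ W' := fun h' => (Finset.disjoint_left.1 h (mem_insert_self a g')) h'
    have hd : Disjoint g' W' := Disjoint.mono_left (subset_insert a g') h
    have haU : a ∉ g' ∪ W' := by
      rw [mem_union, not_or]; exact ⟨ha, haW⟩
    rw [insert_union, sum_powerset_insert haU, sum_powerset_insert ha, ih hd f, ih hd (fun T => f (insert a T))]
    congr 1
    refine sum_congr rfl fun S _ => sum_congr rfl fun X _ => ?_
    rw [insert_union]

omit [Fintype α] in
/-- `(g ∪ W') ∖ (S ∪ X) = (g ∖ S) ∪ (W' ∖ X)` for `S ⊆ g`, `X ⊆ W'`, `g, W'` disjoint. [folklore] -/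
theorem union_sdiff_union_eq {g W' S X : Finset α} (h : Disjoint g W') (hS : S ⊆ g) (hX : X ⊆ W') :
    (g ∪ W') \ (S ∪ X) = (g \ S) ∪ (W' \ X) := by
  ext x
  simp only [mem_sdiff, mem_union, not_or]
  constructor
  · rintro ⟨hx | hx, h1, h2⟩
    · exact Or.inl ⟨hx, h1⟩
    · exact Or.inr ⟨hx, h2⟩
  · rintro (⟨hx, h1⟩ | ⟨hx, h2⟩)
    · exact ⟨Or.inl hx, h1, fun hxX => Finset.disjoint_left.1 h hx (hX hxX)⟩
    · exact ⟨Or.inr hx, fun hxS => Finset.disjoint_left.1 h (hS hxS) hx, h2⟩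

omit [Fintype α] in
/-- Under the least-element hypothesis: label `1` forces `g ⊆ S`. [this work] -/
theorem subset_of_lab_eq_one {g : Finset α} (hC : ∀ S ∈ F.V 0, S ∉ F.A → g ⊆ S) {S : Finset α} (h1 : F.lab S = 1) :
    g ⊆ S := by
  have hV : S ∈ F.V 0 := (F.lab_V0_iff S).1 (Or.inl h1)
  have hA : S ∉ F.A := fun hA => by
    have := (F.lab_eq_four_iff S).2 hA
    rw [h1] at this; exact absurd this (by decide)
  exact hC S hV hA

omit [Fintype α] in
/-- `g ∈ V 0` and `g ⊆ S` give `lab S ∈ {1, ⊤}`. [this work] -/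
theorem lab_of_subset {g : Finset α} (hg : g ∈ F.V 0) {S : Finset α} (h : g ⊆ S) : F.lab S = 1 ∨ F.lab S = 4 :=
  (F.lab_V0_iff S).2 (F.upper 0 h hg)

/-- **The cube inequality**: if petal `0` has a least element `g` (`g ∈ V 0`, every petal-`0` set contains `g`, `g ≠ ∅`), then on every cube `W`
the antipodal pairs labelled `(1,⊤)` or `(⊤,1)` are at most the Gladkov surplus `Σ_{T ⊆ W} kk (lab T) (lab (W ∖ T))`. [this work] -/
theorem cube_le {g : Finset α} (hne : g.Nonempty) (hg : g ∈ F.V 0) (hC : ∀ S ∈ F.V 0, S ∉ F.A → g ⊆ S) (W : Finset α) :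
    ∑ T ∈ W.powerset, (ind14 (F.lab T) (F.lab (W \ T)) + ind14 (F.lab (W \ T)) (F.lab T))
      ≤ ∑ T ∈ W.powerset, kk (F.lab T) (F.lab (W \ T)) := by
  by_cases hgW : g ⊆ W
  swap
  · -- no label-1 set inside the cube: the left side vanishes, the right side is antipodal Gladkov
    have h0 : ∀ T ∈ W.powerset, ind14 (F.lab T) (F.lab (W \ T)) + ind14 (F.lab (W \ T)) (F.lab T) = 0 := by
      intro T hT
      have hTW : T ⊆ W := mem_powerset.1 hT
      have h1 : F.lab T ≠ 1 := fun h => hgW ((F.subset_of_lab_eq_one hC h).trans hTW)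
      have h2 : F.lab (W \ T) ≠ 1 := fun h => hgW ((F.subset_of_lab_eq_one hC h).trans sdiff_subset)
      unfold ind14
      rw [if_neg (fun h => h1 h.1), if_neg (fun h => h2 h.1)]; rfl
    rw [sum_congr rfl h0, sum_const_zero]
    exact F.antipodal_gladkov W
  · set W' := W \ g with hW'
    have hd : Disjoint g W' := disjoint_sdiff
    have hW : W = g ∪ W' := (union_sdiff_of_subset hgW).symm
    rw [hW, sum_powerset_union_of_disjoint hd, sum_powerset_union_of_disjoint hd]
    have hΘ := F.theta_nonneg g W' ∅
    -- termwise identification with `ψ_∅`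
    have key : ∀ S ∈ g.powerset, ∀ X ∈ W'.powerset,
        kk (F.lab (S ∪ X)) (F.lab ((g ∪ W') \ (S ∪ X)))
          - (ind14 (F.lab (S ∪ X)) (F.lab ((g ∪ W') \ (S ∪ X))) + ind14 (F.lab ((g ∪ W') \ (S ∪ X))) (F.lab (S ∪ X)))
          = F.psi g ∅ W' S X := by
      intro S hS X hX
      have hSg : S ⊆ g := mem_powerset.1 hS
      have hXW : X ⊆ W' := mem_powerset.1 hX
      rw [union_sdiff_union_eq hd hSg hXW]
      -- no subset of `W'` and no proper part of `g` contains `g`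
      have hXg : ¬ g ⊆ X := fun h => by
        obtain ⟨x, hx⟩ := hne
        exact Finset.disjoint_left.1 hd hx (hXW (h hx))
      have hYg : ¬ g ⊆ W' \ X := fun h => by
        obtain ⟨x, hx⟩ := hne
        exact Finset.disjoint_left.1 hd hx (sdiff_subset (h hx))
      unfold psi
      by_cases h1 : S = g
      · subst h1
        simp only [if_true, sdiff_self, bot_eq_empty, empty_union, union_empty]
        have hx := F.lab_of_subset hg (subset_union_left (s₁ := S) (s₂ := X))
        have hy : F.lab (W' \ X) ≠ 1 := fun h => hYg (F.subset_of_lab_eq_one hC h)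
        have e1 := kk_eq_v23 _ _ hx hy
        have e2 : ind14 (F.lab (W' \ X)) (F.lab (S ∪ X)) = 0 := by
          unfold ind14; rw [if_neg (fun h => hy h.1)]
        unfold vS
        rw [e1, e2]; ring
      · rw [if_neg h1]
        by_cases h2 : S = ∅
        · subst h2
          simp only [if_true, sdiff_empty, empty_union, union_empty]
          have hx := F.lab_of_subset hg (subset_union_left (s₁ := g) (s₂ := W' \ X))
          have hy : F.lab X ≠ 1 := fun h => hXg (F.subset_of_lab_eq_one hC h)
          have e1 := kk_eq_v23 _ _ hx hy
          have e2 : ind14 (F.lab X) (F.lab (g ∪ (W' \ X))) = 0 := by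
            unfold ind14; rw [if_neg (fun h => hy h.1)]
          unfold vS
          rw [kk_comm, e1, e2]; ring
        · rw [if_neg h2]
          simp only [union_empty]
          have hx : F.lab (S ∪ X) ≠ 1 := fun h => by
            have hgS : g ⊆ S := by
              intro x hx
              have := F.subset_of_lab_eq_one hC h hx
              rcases mem_union.1 this with h' | h'
              · exact h'
              · exact absurd (hXW h') (Finset.disjoint_left.1 hd hx)
            exact h1 (subset_antisymm hSg hgS)
          have hy : F.lab (g \ S ∪ (W' \ X)) ≠ 1 := fun h => by
            have hgS : g ⊆ g \ S := by
              intro x hx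
              have := F.subset_of_lab_eq_one hC h hx
              rcases mem_union.1 this with h' | h'
              · exact h'
              · exact absurd (sdiff_subset h') (Finset.disjoint_left.1 hd hx)
            apply h2
            ext x
            simp only [Finset.notMem_empty, iff_false]
            intro hxS
            have := hgS (hSg hxS)
            rw [mem_sdiff] at this
            exact this.2 hxS
          have e1 : ind14 (F.lab (S ∪ X)) (F.lab (g \ S ∪ (W' \ X))) = 0 := by
            unfold ind14; rw [if_neg (fun h => hx h.1)]
          have e2 : ind14 (F.lab (g \ S ∪ (W' \ X))) (F.lab (S ∪ X)) = 0 := by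
            unfold ind14; rw [if_neg (fun h => hy h.1)]
          rw [e1, e2]; ring
    have hsum : ∑ S ∈ g.powerset, ∑ X ∈ W'.powerset,
        (kk (F.lab (S ∪ X)) (F.lab ((g ∪ W') \ (S ∪ X)))
          - (ind14 (F.lab (S ∪ X)) (F.lab ((g ∪ W') \ (S ∪ X))) + ind14 (F.lab ((g ∪ W') \ (S ∪ X))) (F.lab (S ∪ X))))
        = ∑ S ∈ g.powerset, ∑ X ∈ W'.powerset, F.psi g ∅ W' S X :=
      sum_congr rfl fun S hS => sum_congr rfl fun X hX => key S hS X hX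
    rw [← hsum] at hΘ
    simp only [sum_sub_distrib] at hΘ
    linarith

end Sunflower

end Summit.CriticalPhenomena.PercolationContinuityZ3.Theorems.SunflowerPartition
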